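import Literature.NumberTheory.Automorphic.Liu2021.AppendixC.JacobianFanPullbackWord
import HarnessLib

/-!
# DECK INVARIANCE of the fan pull-back word: `p^* ≫ δ_* = p^*` on the biproducts of piece Jacobians
# (Lang VIII §6 Thm. 13; LR22 Prop. 3.5.1 «`Nm_G = f^* ∘ Nm_f`»; SGA 1 V §1)

Topic `NumberTheory/Automorphic/Liu2021/AppendixC`; namespace `Literature.NumberTheory.Automorphic.Liu2021.AppendixC` (prefix `Jacobian.`).
PROOF FILE (theorems only; no definition, no named fact, no instance, no `sorry`).  Sequel of ★ `JacobianFanPullbackWord` (same setting, over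
`ℂ`: a quotient `p : X′ → X = X′/Δ` of a projective scheme by a finite group for separated test objects, colimit cofans of smooth projective
curves `eN c′ : E_N c′ → X′`, `eK c : E_K c → X` with Jacobians, biproduct fans `πN/ιN`, `πK/ιK` on abelian varieties `Y_N`, `Y_K`, the piece
maps `tu c′ : E_N c′ → E_K (bN c′)` of `p`, piece lifts `tδ δ c′` of the `act δ`; the matrix entries `M δ c₁ c₂ = Nm` of THE lift
`E_N c₁ → E_N c₂` of `act δ`, else `0`).

* `Jacobian.fan_lift_matrix_mul` — THE LIFT MATRICES MULTIPLY: `Σ_{c′} M δ c₁ c′ ≫ M d c′ c″ = M (dδ) c₁ c″` (`(act (dδ)).hom =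
  (act δ).hom ≫ (act d).hom`; lifts exist ★ `exists_pieceLift`, are unique ★ `Over.pieceMap_unique`, hit a unique piece ★
  `Over.pieceMap_index_unique`; `Nm_{ℓ ≫ ℓ′} = Nm_ℓ ≫ Nm_{ℓ′}`);
* `Jacobian.sum_pieceLift_word_comp_eq` — `(Σ_δ W_δ) ≫ W_d = Σ_δ W_δ` for the Y-level words `W_δ = Σ_c πN c ≫ Nm_{tδ δ c} ≫ ιN (φδ δ c)` of the
  deck transformations and the word `W_d` of ANY lift family `(cs, dk)` of one `act d` (matrix forms ★ `Jacobian.fan_pieceLift_word_eq_sum`,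
  re-indexing `δ ↦ dδ`);
* **`Jacobian.exists_fan_pullback_word_deck`** — ★ `Jacobian.exists_fan_pullback_word` (per piece the faithful group `H c′`, the quotient
  property of `tu c′`, the pinned pull-back `ttH c′`, the multiplicity `m c′ ≥ 1`, the fan pinning `Wu ≫ Wt = Σ_δ W_δ`, cancellation of
  `Wu`) PLUS THE DECK INVARIANCE OF THE PULL-BACK WORD: **`Wt ≫ W_d = Wt`** for every `d ∈ Δ` and every lift family `(cs, dk)` of `act d`
  (`Wu ≫ Wt ≫ W_d = (Σ_δ W_δ) ≫ W_d = Σ_δ W_δ = Wu ≫ Wt`, cancel `Wu`) — the identity `p^*` followed by a deck transformation is `p^*`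
  ([LangeRodriguez2022] Prop. 3.5.1: `Nm_G ∘ g_* = Nm_G`).

Cell `hodgecm-mathlib` (D-0151), crux `HLiu418` = stmt-HodgeConjecture-24832, d6 line, `stub_RosH` glue: the `hWd` input of ★
`HeckeEndomorphismTransposedWordScalar` / ★ `fan_entry_deck_invariant` (the trace word is deck invariant at the Y-level), delivered for the
witnesses of ★ `HeckeTraceWordPieces` by the sequel edition there.  COUNT-NEUTRAL capital: HC_CM is proved only modulo the 7 printed
citations until rung 0 closes.

## References
* [Lang1983AbelianVarieties] S. Lang, *Abelian Varieties* (1983), Ch. VIII §6 Thm. 13 (pp. 224–227).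
* [LangeRodriguez2022] H. Lange, R. E. Rodríguez, *Decomposition of Jacobians by Prym Varieties*, LNM 2310 (2022), §3.5.1 Prop. 3.5.1 (p. 65).
* [Lange2023AbelianVarietiesComplex] H. Lange, *Abelian Varieties over the Complex Numbers* (2023), §4.5.2 (the norm map `N_f`).
* [SGA1] A. Grothendieck, M. Raynaud, *SGA 1*, Exp. V §1 Prop. 1.1, 1.8.
* [GortzWedhorn2020] U. Görtz, T. Wedhorn, *Algebraic Geometry I* (2nd ed.), §(3.5) Prop. 3.10, Example 3.11 (p. 73).
* [MumfordAV1970] D. Mumford, *Abelian Varieties* (1970), §7 Thm. p. 66 and Remark.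
-/

set_option autoImplicit false

noncomputable section

open CategoryTheory CategoryTheory.Limits AlgebraicGeometry
open Literature.AlgebraicGeometry.Motives
open Literature.AlgebraicGeometry.Morphisms (Over.pieceMap_unique Over.pieceMap_index_unique)

namespace Literature.NumberTheory.Automorphic.Liu2021.AppendixC

section FanDeck

variable {X' X : SchemeOver ℂ} {Δ : Type} [Group Δ] [Fintype Δ] (act : Δ →* Aut X') (p : X' ⟶ X)
  -- pieces of `X'`
  {CN : Type} [Fintype CN] (EN : CN → SchemeOver ℂ) (eN : ∀ c, EN c ⟶ X')
  (JN : ∀ c, Jacobian (EN c))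
  -- pieces of `X`
  {CK : Type} [Fintype CK] (EK : CK → SchemeOver ℂ) (eK : ∀ c, EK c ⟶ X)
  (JK : ∀ c, Jacobian (EK c))
  -- piece maps of `p`
  (bN : CN → CK) (tu : ∀ c', EN c' ⟶ EK (bN c'))

omit [Fintype Δ] [Fintype CK] in
open scoped Classical in
/-- **The lift matrices multiply**: `Σ_{c′} M δ c₁ c′ ≫ M d c′ c″ = M (dδ) c₁ c″`, where `M δ c₁ c₂ = Nm_ℓ` for THE lift `ℓ : E_N c₁ → E_N c₂` of
`act δ` through the cofan (else `0`): the lift of `act δ` from `c₁` lands in one piece `c⋆`, the lift of `act d` from `c⋆` in one piece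
`c⋆⋆`, their composite is THE lift of `act (dδ)` (`(act (dδ)).hom = (act δ).hom ≫ (act d).hom`), and `Nm_{ℓ ≫ ℓ′} = Nm_ℓ ≫ Nm_{ℓ′}`.
[cite: GortzWedhorn2020, §(3.5) Proposition 3.10 and Example 3.11 (p. 73)] [cite: Lange2023AbelianVarietiesComplex, §4.5.2 (the norm map N_f)] -/
theorem Jacobian.fan_lift_matrix_mul (hcN : IsColimit (Cofan.mk X' eN)) [∀ c, IsIntegral (EN c).left] (δ d : Δ) (c₁ c₃ : CN) :
    (∑ c₂, (if h : ∃ ℓ : EN c₁ ⟶ EN c₂, ℓ ≫ eN c₂ = eN c₁ ≫ (act δ).hom then (JN c₁).pushforward (JN c₂) h.choose else 0) ≫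
        (if h : ∃ ℓ : EN c₂ ⟶ EN c₃, ℓ ≫ eN c₃ = eN c₂ ≫ (act d).hom then (JN c₂).pushforward (JN c₃) h.choose else 0)) =
      (if h : ∃ ℓ : EN c₁ ⟶ EN c₃, ℓ ≫ eN c₃ = eN c₁ ≫ (act (d * δ)).hom then (JN c₁).pushforward (JN c₃) h.choose else 0) := by
  obtain ⟨cs, ℓ, hℓ⟩ := exists_pieceLift act eN hcN δ c₁
  obtain ⟨css, ℓ', hℓ'⟩ := exists_pieceLift act eN hcN d cs
  have hmul : (act (d * δ)).hom = (act δ).hom ≫ (act d).hom := by rw [map_mul]; rfl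
  have hcomp : (ℓ ≫ ℓ') ≫ eN css = eN c₁ ≫ (act (d * δ)).hom := by rw [Category.assoc, hℓ', reassoc_of% hℓ, hmul]
  rw [Finset.sum_eq_single cs]
  · have h1 : ∃ ℓ₁ : EN c₁ ⟶ EN cs, ℓ₁ ≫ eN cs = eN c₁ ≫ (act δ).hom := ⟨ℓ, hℓ⟩
    rw [dif_pos h1, Over.pieceMap_unique hcN (f' := eN) (T := (act δ).hom) h1.choose ℓ h1.choose_spec hℓ]
    by_cases hc : c₃ = css
    · subst hc
      have h2 : ∃ ℓ₂ : EN cs ⟶ EN c₃, ℓ₂ ≫ eN c₃ = eN cs ≫ (act d).hom := ⟨ℓ', hℓ'⟩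
      have h3 : ∃ ℓ₃ : EN c₁ ⟶ EN c₃, ℓ₃ ≫ eN c₃ = eN c₁ ≫ (act (d * δ)).hom := ⟨ℓ ≫ ℓ', hcomp⟩
      rw [dif_pos h2, dif_pos h3, Over.pieceMap_unique hcN (f' := eN) (T := (act d).hom) h2.choose ℓ' h2.choose_spec hℓ',
        Over.pieceMap_unique hcN (f' := eN) (T := (act (d * δ)).hom) h3.choose (ℓ ≫ ℓ') h3.choose_spec hcomp,
        (JN c₁).pushforward_comp (JN cs) (JN c₃) ℓ ℓ']
    · have h2 : ¬ ∃ ℓ₂ : EN cs ⟶ EN c₃, ℓ₂ ≫ eN c₃ = eN cs ≫ (act d).hom := by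
        rintro ⟨ℓ₂, hℓ₂⟩
        exact hc (Over.pieceMap_index_unique hcN (f' := eN) (T := (act d).hom) ℓ₂ ℓ' hℓ₂ hℓ')
      have h3 : ¬ ∃ ℓ₃ : EN c₁ ⟶ EN c₃, ℓ₃ ≫ eN c₃ = eN c₁ ≫ (act (d * δ)).hom := by
        rintro ⟨ℓ₃, hℓ₃⟩
        exact hc (Over.pieceMap_index_unique hcN (f' := eN) (T := (act (d * δ)).hom) ℓ₃ (ℓ ≫ ℓ') hℓ₃ hcomp)
      rw [dif_neg h2, dif_neg h3, comp_zero]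
  · intro c₂ _ hc₂
    rw [dif_neg, zero_comp]
    rintro ⟨ℓ₁, hℓ₁⟩
    exact hc₂ (Over.pieceMap_index_unique hcN (f' := eN) (T := (act δ).hom) ℓ₁ ℓ hℓ₁ hℓ)
  · intro h; exact absurd (Finset.mem_univ _) h

omit [Fintype CK] in
open scoped Classical in
/-- **The sum of the deck words absorbs one more deck word**: `(Σ_δ W_δ) ≫ W_d = Σ_δ W_δ`, where `W_δ = Σ_c πN c ≫ Nm_{tδ δ c} ≫ ιN (φδ δ c)` are the
Y-level words of chosen piece lifts of the `act δ` and `W_d` is the word of ANY lift family `(cs, dk)` of `act d` — both are the lift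
MATRICES (★ `Jacobian.fan_pieceLift_word_eq_sum`), which multiply (`fan_lift_matrix_mul`), and `δ ↦ dδ` re-indexes the sum.
[cite: Lang1983AbelianVarieties, Ch. VIII §6, Thm. 13 (pp. 224–227)] [cite: GortzWedhorn2020, §(3.5) Proposition 3.10 and Example 3.11 (p. 73)] -/
theorem Jacobian.sum_pieceLift_word_comp_eq {YN : AbelianVariety ℂ} (πN : ∀ c, YN ⟶ (JN c).J) (ιN : ∀ c, (JN c).J ⟶ YN)
    (hιπN : ∀ c, ιN c ≫ πN c = 𝟙 _) (hιπN' : ∀ c₁ c₂, c₁ ≠ c₂ → ιN c₁ ≫ πN c₂ = 0)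
    (hcN : IsColimit (Cofan.mk X' eN)) [∀ c, IsIntegral (EN c).left]
    (φδ : Δ → CN → CN) (tδ : ∀ δ c', EN c' ⟶ EN (φδ δ c'))
    (htδ : ∀ δ c', tδ δ c' ≫ eN (φδ δ c') = eN c' ≫ (act δ).hom)
    (d : Δ) (cs : CN → CN) (dk : ∀ c, EN c ⟶ EN (cs c)) (hdk : ∀ c, dk c ≫ eN (cs c) = eN c ≫ (act d).hom) :
    (∑ δ, ∑ c, πN c ≫ (JN c).pushforward (JN (φδ δ c)) (tδ δ c) ≫ ιN (φδ δ c)) ≫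
        (∑ c, πN c ≫ (JN c).pushforward (JN (cs c)) (dk c) ≫ ιN (cs c)) =
      ∑ δ, ∑ c, πN c ≫ (JN c).pushforward (JN (φδ δ c)) (tδ δ c) ≫ ιN (φδ δ c) := by
  -- matrix forms of all the words
  rw [Finset.sum_congr rfl fun δ _ => Finset.sum_congr rfl fun c _ =>
      Jacobian.fan_pieceLift_word_eq_sum act EN eN JN πN ιN hcN δ c (tδ δ c) (htδ δ c),
    Finset.sum_congr rfl fun c _ => Jacobian.fan_pieceLift_word_eq_sum act EN eN JN πN ιN hcN d c (dk c) (hdk c)]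
  -- re-index the right-hand side by `δ ↦ d * δ`
  conv_rhs => rw [← Equiv.sum_comp (Equiv.mulLeft d)]
  simp only [Equiv.coe_mulLeft]
  rw [Preadditive.sum_comp]
  refine Finset.sum_congr rfl fun δ _ => ?_
  rw [Preadditive.sum_comp]
  refine Finset.sum_congr rfl fun c₁ _ => ?_
  -- row `c₁`: contract `ιN c₂ ≫ πN c`, then multiply the matrices
  rw [Preadditive.sum_comp]
  have hrow : ∀ c₂ : CN,
      (πN c₁ ≫ (if h : ∃ ℓ : EN c₁ ⟶ EN c₂, ℓ ≫ eN c₂ = eN c₁ ≫ (act δ).hom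
          then (JN c₁).pushforward (JN c₂) h.choose else 0) ≫ ιN c₂) ≫
        (∑ c, ∑ c₃, πN c ≫ (if h : ∃ ℓ : EN c ⟶ EN c₃, ℓ ≫ eN c₃ = eN c ≫ (act d).hom
          then (JN c).pushforward (JN c₃) h.choose else 0) ≫ ιN c₃) =
      ∑ c₃, πN c₁ ≫ ((if h : ∃ ℓ : EN c₁ ⟶ EN c₂, ℓ ≫ eN c₂ = eN c₁ ≫ (act δ).hom
          then (JN c₁).pushforward (JN c₂) h.choose else 0) ≫
        (if h : ∃ ℓ : EN c₂ ⟶ EN c₃, ℓ ≫ eN c₃ = eN c₂ ≫ (act d).hom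
          then (JN c₂).pushforward (JN c₃) h.choose else 0)) ≫ ιN c₃ := by
    intro c₂
    rw [Preadditive.comp_sum, Finset.sum_eq_single c₂]
    · rw [Preadditive.comp_sum]
      refine Finset.sum_congr rfl fun c₃ _ => ?_
      simp only [Category.assoc]
      rw [reassoc_of% (hιπN c₂)]
    · intro c _ hc
      rw [Preadditive.comp_sum]
      refine Finset.sum_eq_zero fun c₃ _ => ?_
      simp only [Category.assoc]
      rw [reassoc_of% (hιπN' c₂ c (Ne.symm hc)), zero_comp, comp_zero, comp_zero]
    · intro h; exact absurd (Finset.mem_univ _) h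
  rw [Finset.sum_congr rfl fun c₂ _ => hrow c₂, Finset.sum_comm]
  refine Finset.sum_congr rfl fun c₃ _ => ?_
  rw [← Preadditive.comp_sum, ← Preadditive.sum_comp, Jacobian.fan_lift_matrix_mul act EN eN JN hcN δ d c₁ c₃]

open scoped Classical in
/-- **THE FAN PINNING OF THE PULL-BACK WORD, WITH ITS DECK INVARIANCE** — ★ `Jacobian.exists_fan_pullback_word` (per piece `c′` of `X′`: the
finite group `H c′ ≤ Aut (E_N c′)` of lifts of its stabiliser, for which `tu c′` is a quotient for separated test objects; the pinned pull-back
`ttH c′`, `Nm_{tu c′} ≫ ttH c′ = Σ_{h ∈ H c′} h_*`; a multiplicity `m c′ ≥ 1`; the fan pinning `Wu ≫ Wt = Σ_δ W_δ` of `Wu := Σ_{c′} πN c′ ≫ Nm_{tu c′} ≫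
ιK (bN c′)`, `Wt := Σ_{c′} πK (bN c′) ≫ (m c′ • ttH c′) ≫ ιN c′`; right-cancellation of `Wu`) AND, for the same witnesses, **`Wt ≫ W_d = Wt`** for
every `d ∈ Δ` and every lift family `cs : C_N → C_N`, `dk c : E_N c → E_N (cs c)` of `act d` (`W_d := Σ_c πN c ≫ Nm_{dk c} ≫ ιN (cs c)`): the
pull-back followed by a deck transformation is the pull-back ([LangeRodriguez2022] Prop. 3.5.1; proof `Wu ≫ Wt ≫ W_d = (Σ_δ W_δ) ≫ W_d =
Σ_δ W_δ = Wu ≫ Wt` by `sum_pieceLift_word_comp_eq`, then cancel `Wu`). [cite: Lang1983AbelianVarieties, Ch. VIII §6, Thm. 13 (pp. 224–227)]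
[cite: LangeRodriguez2022, §3.5.1 Prop. 3.5.1 (p. 65)] [cite: MumfordAV1970, §7 Thm. p. 66 and Remark] [cite: SGA1, Exp. V §1 Prop. 1.1, 1.8] -/
theorem Jacobian.exists_fan_pullback_word_deck {YN YK : AbelianVariety ℂ}
    (πN : ∀ c, YN ⟶ (JN c).J) (ιN : ∀ c, (JN c).J ⟶ YN) (πK : ∀ c, YK ⟶ (JK c).J) (ιK : ∀ c, (JK c).J ⟶ YK)
    (hιπN : ∀ c, ιN c ≫ πN c = 𝟙 _) (hιπN' : ∀ c₁ c₂, c₁ ≠ c₂ → ιN c₁ ≫ πN c₂ = 0)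
    (htotK : ∑ c, πK c ≫ ιK c = 𝟙 YK) (hιπK : ∀ c, ιK c ≫ πK c = 𝟙 _) (hιπK' : ∀ c₁ c₂, c₁ ≠ c₂ → ιK c₁ ≫ πK c₂ = 0)
    (hX' : IsProjectiveOver X') (hX : IsSeparated X.hom) (hp : IsSepQuotient (fun δ => act δ) p)
    (hcN : IsColimit (Cofan.mk X' eN)) (hEN : ∀ c, IsSmoothProjective 1 (EN c))
    (hcK : IsColimit (Cofan.mk X eK)) (hEK : ∀ c, IsSmoothProjective 1 (EK c))
    (htu : ∀ c', tu c' ≫ eK (bN c') = eN c' ≫ p)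
    (φδ : Δ → CN → CN) (tδ : ∀ δ c', EN c' ⟶ EN (φδ δ c'))
    (htδ : ∀ δ c', tδ δ c' ≫ eN (φδ δ c') = eN c' ≫ (act δ).hom) :
    ∃ (H : ∀ c', Subgroup (Aut (EN c'))) (_ : ∀ c', Finite ↥(H c'))
      (_ : ∀ c', IsSepQuotient (fun h : ↥(H c') => (h : Aut (EN c'))) (tu c'))
      (ttH : ∀ c', (JK (bN c')).J ⟶ (JN c').J) (m : CN → ℕ),
      (∀ c', 0 < m c') ∧
      (∀ c', haveI := Fintype.ofFinite ↥(H c');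
        (JN c').pushforward (JK (bN c')) (tu c') ≫ ttH c' =
          ∑ h : ↥(H c'), (JN c').pushforward (JN c') (h : Aut (EN c')).hom) ∧
      (∑ c', πN c' ≫ (JN c').pushforward (JK (bN c')) (tu c') ≫ ιK (bN c')) ≫
          (∑ c', πK (bN c') ≫ ((m c' : ℤ) • ttH c') ≫ ιN c') =
        ∑ δ, ∑ c', πN c' ≫ (JN c').pushforward (JN (φδ δ c')) (tδ δ c') ≫ ιN (φδ δ c') ∧
      (∀ ⦃Z : AbelianVariety ℂ⦄ ⦃a b : YK ⟶ Z⦄,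
        (∑ c', πN c' ≫ (JN c').pushforward (JK (bN c')) (tu c') ≫ ιK (bN c')) ≫ a =
          (∑ c', πN c' ≫ (JN c').pushforward (JK (bN c')) (tu c') ≫ ιK (bN c')) ≫ b → a = b) ∧
      (∀ (d : Δ) (cs : CN → CN) (dk : ∀ c, EN c ⟶ EN (cs c)),
        (∀ c, dk c ≫ eN (cs c) = eN c ≫ (act d).hom) →
        (∑ c', πK (bN c') ≫ ((m c' : ℤ) • ttH c') ≫ ιN c') ≫
            (∑ c, πN c ≫ (JN c).pushforward (JN (cs c)) (dk c) ≫ ιN (cs c)) =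
          ∑ c', πK (bN c') ≫ ((m c' : ℤ) • ttH c') ≫ ιN c') := by
  haveI : ∀ c, IsIntegral (EN c).left := fun c => IsSmoothProjective.isIntegral_holds (hEN c)
  obtain ⟨H, hfin, hq, ttH, m, hm, httH, hpinY, hcancel⟩ :=
    Jacobian.exists_fan_pullback_word act p EN eN JN EK eK JK bN tu πN ιN πK ιK hιπN hιπN' htotK hιπK hιπK' hX' hX hp
      hcN hEN hcK hEK htu φδ tδ htδ
  refine ⟨H, hfin, hq, ttH, m, hm, httH, hpinY, hcancel, fun d cs dk hdk => hcancel ?_⟩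
  rw [← Category.assoc, hpinY]
  exact Jacobian.sum_pieceLift_word_comp_eq act EN eN JN πN ιN hιπN hιπN' hcN φδ tδ htδ d cs dk hdk

end FanDeck

end Literature.NumberTheory.Automorphic.Liu2021.AppendixC

end
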